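/-
Copyright (c) 2026 the pub-hodgecm-mathlib formalisation cell (harness21).  Prover seat hodgecm-mathlib-F0P2-p08 (g2), Track B «K2-LIT»,
#184♮ = hLiu418 = `stmt-HodgeConjecture-24832`; socket #41 `sig_K2LiuSiegelEisensteinContinuation`, KIND W, (x-a) edition 3 STAGE «ASSEMBLY»: the ∃-head
`exists_kindW_eulerLetters_of_letters` — the TOP's `A` (continued `T`-part, `:= 0` at `det S = 0`) with `hEuler`, `hAd`, `hdet0` and the Σ∏ PRESENTATION, from
per-place CONTINUED local letters carried BY VALUE (desk ruling 2026-09-04T22:15:21Z; LEAD F0P6-plan (g14) BATCH #66 (4); conjunct list agreed with (x-b) K2E4-p10 (g9)).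
THEOREMS ONLY (no `def`, no `instance`, no notation, no named-fact hypothesis, no `sorry`).
-/
import Summits.HodgeConjecture.HodgeConjecture.Theorems.K2LiuSiegelEisensteinKindWLetters           -- ★ (x-a) ED. 1–2: `kindWPlaces`, `kindWFinset`, `kindWPart`, (W1) `whittakerDelta_eq_kindWPart_mul`
import Summits.HodgeConjecture.HodgeConjecture.Theorems.K2LiuSiegelEisensteinWhittakerFactorLetters  -- ★ p862052∕p862137 (frame of the TOP's KIND-W block: `skewMatrices`, `gramR`)
import Mathlib.Analysis.Calculus.Deriv.Mul
import HarnessLib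

/-!
# Crux `HLiu418`, socket #41, KIND W — `K2LiuSiegelEisensteinKindWEulerLetters` ((x-a) edition 3, STAGE «ASSEMBLY»): THE ∃-HEAD
# `∃ A, hEuler ∧ hAd ∧ hdet0 ∧ PRES` FROM CONTINUED LOCAL LETTERS

Cell `hodgecm-mathlib`, crux item hLiu418 = `stmt-HodgeConjecture-24832`, route of record `HCCMUnconditional`; squad K2 ∕ K2Liu, road `K2_Liu`, socket #41 (TOP ED. 15∕16
KIND-W binder block `(A) (U) (hEuler) (hAd) …`).  Desk ruling K2E5-p17 (g8) 22:15:21Z: «`A` is ∃-bound = the CONTINUED `T`-part, assembled INSIDE the proof from the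
continued local Whittaker functions per place, `A = kindWPart …` on the half-plane by ★ G1 + Fubini + “continued = integral” per place»; K2E4-p10 (g9) FILE 3 STAGE 1
`exists_kindW_letters_of_globalLetters` consumes EXACTLY `∃ A, hEuler ∧ hAd ∧ hdet0 ∧ PRES`.  THIS FILE is that ∃-head as an ASSEMBLY over by-value letters
(lane `--supports stmt-HodgeConjecture-24832`, count-neutral helper; closes no socket by itself):

**`exists_kindW_eulerLetters_of_letters`.**  INPUTS: ★ G1's Whittaker–Euler data specification (`T₀ νN νv hνK νinf hσ hmap χ hχ f fT hfac`, as ★ (x-a) §3); the global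
integrability `hG` on `{n∕2 < re s}` at non-singular indices (★ O41.3 at the datum); the rank-two per-place letter `hJ` off `U(S,h)` (★ glue `integral_unipDeltaLoc_lambdaLoc_eq_of_one_lt_re`
per place); CONTINUED LOCAL LETTERS `Finf j S s h` (archimedean, already multiplied over `w ∣ ∞`) and `Ffin j S h v s` (finite places), `j < m`, holomorphic in `s` on
`{0 < re s}` (`hFinf`, `hFfin` — ★ junction `kFiniteSection_whittaker_holomorphy_growth` ∕ ★ Φ5–G3 ∕ ★ `K2LiuGoodPlaceWhittaker*`); and ONE half-plane identity `hPart`: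
«on `{n∕2 < re s}`, `det S ≠ 0`: `I_{U(S,h)}(S,s,h) = Σ_j Finf j S s h · ∏_{v ∈ U(S,h)} Ffin j S h v s`» (= ★ ED. 2 §4's Fubini `whittakerDelta_eq_sum_mul_prod_mul` ∘ the Σ⊗
structure of the `T`-part ∘ «continued = integral» per place — the successor's STAGE «LOCAL»).  OUTPUT: `∃ A`, with
`A S s h := if det S = 0 then 0 else Σ_j Finf j S s h · ∏_{v∈U(S,h)} Ffin j S h v s`, of (i) the TOP's `hEuler` bytes with `U := fun S h => kindWPlaces ↑T₀ ↑S h`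
(★ (x-a) §3 + `hPart`), (ii) the TOP's `hAd` bytes (finite sums of finite products of holomorphic functions; the constant `0` at singular `S`), (iii) `hdet0`, (iv) PRES.
HONEST LABEL.  Count-neutral helper; it retires nothing by itself (the letters `hG hJ hFinf hFfin hPart` are the (x-a) STAGE «LOCAL» residue): `HC_CM` is proved only modulo the
7 printed citations (2 remaining named inputs: hLiu418 = `stmt-HodgeConjecture-24832`, h413 = `stmt-HodgeConjecture-24833`) until rung 0 closes.

## References
* [KudlaRallis1994] S. Kudla, S. Rallis, Ann. of Math. 140 (1994): §1 (Fourier coefficients of Siegel Eisenstein series as Euler products; continuation termwise).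
* [Tan1999] V. Tan, Canad. J. Math. 51 (1999): §2–§3.   * [Shimura1997] G. Shimura, CBMS 93 (1997): §18–§19 (continued confluent hypergeometric ∕ local Whittaker functions).
-/

set_option autoImplicit false
-- the mandated namespace repeats the single-problem summit's segment (`HodgeConjecture.HodgeConjecture`)
set_option linter.dupNamespace false

noncomputable section

open scoped Matrix RestrictedProduct ENNReal NNReal Topology ComplexConjugate BigOperators
open NumberField IsDedekindDomain MeasureTheory Measure Filter Set

namespace Summit.HodgeConjecture.HodgeConjecture.Cruxes.HLiu418.K2LiuSiegelEisensteinKindWEulerLetters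

open Literature.NumberTheory.Automorphic Literature.NumberTheory.GaloisRepresentations Literature.NumberTheory.LFunctions
open Literature.NumberTheory.GelbartRogawski1991 Literature.NumberTheory.GelbartRogawski1991.GRConstruction
open Literature.NumberTheory.K2Lit.SiegelDoubled
open Literature.NumberTheory.K2Lit.PlaceSplitting
open Literature.MeasureTheory.RestrictedProduct
open Literature.Topology.Algebra.RestrictedProduct (inH)
open Summit.HodgeConjecture.HodgeConjecture.Cruxes.HLiu418.K2LiuSiegelUnipotentLocalDefs
open Summit.HodgeConjecture.HodgeConjecture.Cruxes.HLiu418.K2LiuSiegelUnipotentSplitDefs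
open Summit.HodgeConjecture.HodgeConjecture.Cruxes.HLiu418.K2LiuSiegelUnipotentSplitAtDefs
open Summit.HodgeConjecture.HodgeConjecture.Cruxes.HLiu418.K2LiuSiegelUnipotentHaarPinned
open Summit.HodgeConjecture.HodgeConjecture.Cruxes.HLiu418.K2LiuSiegelUnipotentEulerProduct
open Summit.HodgeConjecture.HodgeConjecture.Cruxes.HLiu418.K2LiuSiegelUnipotentFourierDefs
open Summit.HodgeConjecture.HodgeConjecture.Cruxes.HLiu418.K2LiuWhittakerDeltaEulerHead
open Summit.HodgeConjecture.HodgeConjecture.Cruxes.HLiu418.K2LiuWhittakerDeltaEulerProduct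
open Summit.HodgeConjecture.HodgeConjecture.Cruxes.HLiu418.K2LiuSiegelEisensteinKindWLetters

variable (L : Type) [Field L] [NumberField L] [IsCMField L]
variable {N M n : ℕ} (e : Fin N × Fin M ≃ Fin n)
  (dV : Fin N → L) (hdV : ∀ i, IsCMField.complexConj L (dV i) = dV i)
  (dW : Fin M → L) (hdW : ∀ i, IsCMField.complexConj L (dW i) = dW i)
  [DecidableEq (HeightOneSpectrum (𝓞 (Fp L)))]
  [MeasurableSpace ↥(unipDelta L e dV hdV dW hdW)] [BorelSpace ↥(unipDelta L e dV hdV dW hdW)]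
  [MeasurableSpace ↥(unipDeltaArch L e dV hdV dW hdW)] [BorelSpace ↥(unipDeltaArch L e dV hdV dW hdW)]
  [∀ v : HeightOneSpectrum (𝓞 (Fp L)), MeasurableSpace ↥(unipDeltaLoc L e dV hdV dW hdW v)] [∀ v : HeightOneSpectrum (𝓞 (Fp L)), BorelSpace ↥(unipDeltaLoc L e dV hdV dW hdW v)]

/-- **THE KIND-W ∃-HEAD FROM CONTINUED LOCAL LETTERS** (statement and proof in the module header): `∃ A`, `A := 0` at singular indices and
`A := Σ_j Finf j · ∏_{v∈U(S,h)} Ffin j v` otherwise, with (i) the TOP's Euler identity on `{n∕2 < re s}` (★ (x-a) §3 + `hPart`), (ii) holomorphy on `{0 < re s}`,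
(iii) vanishing at `det S = 0`, (iv) the Σ∏ presentation. [cite: KudlaRallis1994, §1] [cite: Tan1999, §2–§3] [cite: Shimura1997, §18] -/
theorem exists_kindW_eulerLetters_of_letters (T₀ : Finset (HeightOneSpectrum (𝓞 (Fp L))))
    (νN : Measure ↥(unipDelta L e dV hdV dW hdW))
    (νv : ∀ v : HeightOneSpectrum (𝓞 (Fp L)), Measure ↥(unipDeltaLoc L e dV hdV dW hdW v)) [∀ v, (νv v).IsHaarMeasure] [∀ v, SigmaFinite (νv v)]
    (hνK : ∀ v, νv v (((inH (fun v => UnitaryGroup.localInt L (IsCMField.complexConj L) (n + n) (hermD L e dV hdV dW hdW) v)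
      (fun v => unipDeltaLoc L e dV hdV dW hdW v) v) : Subgroup ↥(unipDeltaLoc L e dV hdV dW hdW v)) : Set ↥(unipDeltaLoc L e dV hdV dW hdW v)) = 1)
    (νinf : Finset (HeightOneSpectrum (𝓞 (Fp L))) → Measure ↥(unipDeltaArch L e dV hdV dW hdW)) (hσ : ∀ T, SigmaFinite (νinf T))
    (hmap : ∀ T : Finset (HeightOneSpectrum (𝓞 (Fp L))), Measure.map (unipDeltaSplitAt L e dV hdV dW hdW T) νN =
      (νinf T).prod ((Measure.pi fun v : T => νv v.1).prod
        (rpMeasure (fun v : {v : HeightOneSpectrum (𝓞 (Fp L)) // v ∉ T} => ((inH (fun v => UnitaryGroup.localInt L (IsCMField.complexConj L) (n + n) (hermD L e dV hdV dW hdW) v)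
          (fun v => unipDeltaLoc L e dV hdV dW hdW v) v.1 : Subgroup ↥(unipDeltaLoc L e dV hdV dW hdW v.1)) : Set ↥(unipDeltaLoc L e dV hdV dW hdW v.1))) (fun v => νv v.1) ∅)))
    {χ : HeckeCharacter L} (hχ : ∀ v, v ∉ T₀ → ∀ w' : UnitaryGroup.PlacesOver L v, χ.IsUnramifiedAt w'.1)
    {f : ℂ → HA L e dV hdV dW hdW → ℂ}
    {fT : ∀ T : Finset (HeightOneSpectrum (𝓞 (Fp L))), ℂ → UnitaryGroup.arch (Fp L) L (IsCMField.complexConj L) (n + n) (hermD L e dV hdV dW hdW) ×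
      (Π v : T, UnitaryGroup.localPi L (IsCMField.complexConj L) (n + n) (hermD L e dV hdV dW hdW) v.1) → ℂ}
    (hfac : ∀ T : Finset (HeightOneSpectrum (𝓞 (Fp L))), T₀ ⊆ T → IsFactorizableOff L e dV hdV dW hdW T χ f (fT T))
    (hG : ∀ (S : skewMatrices ((IsCMField.complexConj L : L ≃ₐ[Fp L] L) : L →+* L) ((gramR L e dV hdV dW hdW).map (algebraMap (Fp L) L))) (s : ℂ) (h : HA L e dV hdV dW hdW),
      (n : ℝ) / 2 < s.re → (S : Matrix (Fin n) (Fin n) L).det ≠ 0 →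
      Integrable (fun u : ↥(unipDelta L e dV hdV dW hdW) =>
        conj (unipDeltaChar L e dV hdV dW hdW (S : Matrix (Fin n) (Fin n) L) (u : HA L e dV hdV dW hdW) : ℂ) *
          f s (weylDelta L e dV hdV dW hdW * (u : HA L e dV hdV dW hdW) * h)) νN)
    (hJ : ∀ (S : skewMatrices ((IsCMField.complexConj L : L ≃ₐ[Fp L] L) : L →+* L) ((gramR L e dV hdV dW hdW).map (algebraMap (Fp L) L))) (h : HA L e dV hdV dW hdW) (s : ℂ),
      (n : ℝ) / 2 < s.re → (S : Matrix (Fin n) (Fin n) L).det ≠ 0 →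
      ∀ v, v ∉ kindWPlaces L e dV hdV dW hdW (T₀ : Set (HeightOneSpectrum (𝓞 (Fp L)))) (S : Matrix (Fin n) (Fin n) L) h →
        ∫ y, conj (unipDeltaChar L e dV hdV dW hdW (S : Matrix (Fin n) (Fin n) L)
              (locToAdelic L e dV hdV dW hdW v (y : UnitaryGroup.localPi L (IsCMField.complexConj L) (n + n) (hermD L e dV hdV dW hdW) v)) : ℂ) *
            LambdaLoc L e dV hdV dW hdW v χ s
              (UnitaryGroup.evalPlace (Fp L) L (IsCMField.complexConj L) (n + n) (hermD L e dV hdV dW hdW) v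
                  (UnitaryGroup.finPart (Fp L) L (IsCMField.complexConj L) (n + n) (hermD L e dV hdV dW hdW) (weylDelta L e dV hdV dW hdW)) *
                (y : UnitaryGroup.localPi L (IsCMField.complexConj L) (n + n) (hermD L e dV hdV dW hdW) v)) ∂(νv v) =
          (1 - (v.residueCard : ℂ) ^ (-(2 * s + 1))) * (1 - (quadraticHeckeCharCM L).valueAtUniformizer v * (v.residueCard : ℂ) ^ (-(2 * s + 2))))
    -- the CONTINUED local letters (by value) and their holomorphy on `{0 < re s}`
    {m : ℕ} (Finf : Fin m → skewMatrices ((IsCMField.complexConj L : L ≃ₐ[Fp L] L) : L →+* L) ((gramR L e dV hdV dW hdW).map (algebraMap (Fp L) L)) → ℂ → HA L e dV hdV dW hdW → ℂ)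
    (Ffin : Fin m → skewMatrices ((IsCMField.complexConj L : L ≃ₐ[Fp L] L) : L →+* L) ((gramR L e dV hdV dW hdW).map (algebraMap (Fp L) L)) → HA L e dV hdV dW hdW → HeightOneSpectrum (𝓞 (Fp L)) → ℂ → ℂ)
    (hFinf : ∀ j S (h : HA L e dV hdV dW hdW), DifferentiableOn ℂ (fun s => Finf j S s h) {s : ℂ | 0 < s.re})
    (hFfin : ∀ j S (h : HA L e dV hdV dW hdW) v, DifferentiableOn ℂ (Ffin j S h v) {s : ℂ | 0 < s.re})
    -- «I_{U(S,h)} = Σ∏ of the continued letters» on the half-plane of convergence (★ ED. 2 §4 Fubini ∘ Σ⊗ structure ∘ «continued = integral» per place)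
    (hPart : ∀ (S : skewMatrices ((IsCMField.complexConj L : L ≃ₐ[Fp L] L) : L →+* L) ((gramR L e dV hdV dW hdW).map (algebraMap (Fp L) L))) (h : HA L e dV hdV dW hdW) (s : ℂ),
      (n : ℝ) / 2 < s.re → (S : Matrix (Fin n) (Fin n) L).det ≠ 0 →
      kindWPart L e dV hdV dW hdW (kindWFinset L e dV hdV dW hdW T₀ (S : Matrix (Fin n) (Fin n) L) h) (νinf (kindWFinset L e dV hdV dW hdW T₀ (S : Matrix (Fin n) (Fin n) L) h)) νv
          (fT (kindWFinset L e dV hdV dW hdW T₀ (S : Matrix (Fin n) (Fin n) L) h)) (S : Matrix (Fin n) (Fin n) L) s h =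
        ∑ j, Finf j S s h * ∏ v ∈ kindWFinset L e dV hdV dW hdW T₀ (S : Matrix (Fin n) (Fin n) L) h, Ffin j S h v s) :
    ∃ A : skewMatrices ((IsCMField.complexConj L : L ≃ₐ[Fp L] L) : L →+* L) ((gramR L e dV hdV dW hdW).map (algebraMap (Fp L) L)) → ℂ → HA L e dV hdV dW hdW → ℂ,
      (∀ S : skewMatrices ((IsCMField.complexConj L : L ≃ₐ[Fp L] L) : L →+* L) ((gramR L e dV hdV dW hdW).map (algebraMap (Fp L) L)), (S : Matrix (Fin n) (Fin n) L).det ≠ 0 → ∀ (s : ℂ) (h : HA L e dV hdV dW hdW), (n : ℝ) / 2 < s.re →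
        whittakerDelta L e dV hdV dW hdW νN (S : Matrix (Fin n) (Fin n) L) (f s) h =
          A S s h * (partialStandardL (kindWPlaces L e dV hdV dW hdW (T₀ : Set (HeightOneSpectrum (𝓞 (Fp L)))) (S : Matrix (Fin n) (Fin n) L) h) (fun _ => {1}) (2 * s + 1) *
            partialStandardL (kindWPlaces L e dV hdV dW hdW (T₀ : Set (HeightOneSpectrum (𝓞 (Fp L)))) (S : Matrix (Fin n) (Fin n) L) h)
              (fun v => {(quadraticHeckeCharCM L).valueAtUniformizer v}) (2 * s + 2))⁻¹) ∧
      (∀ (S : skewMatrices ((IsCMField.complexConj L : L ≃ₐ[Fp L] L) : L →+* L) ((gramR L e dV hdV dW hdW).map (algebraMap (Fp L) L))) (h : HA L e dV hdV dW hdW), DifferentiableOn ℂ (fun s => A S s h) {s : ℂ | 0 < s.re}) ∧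
      (∀ (S : skewMatrices ((IsCMField.complexConj L : L ≃ₐ[Fp L] L) : L →+* L) ((gramR L e dV hdV dW hdW).map (algebraMap (Fp L) L))) (s : ℂ) (h : HA L e dV hdV dW hdW), (S : Matrix (Fin n) (Fin n) L).det = 0 → A S s h = 0) ∧
      (∀ (S : skewMatrices ((IsCMField.complexConj L : L ≃ₐ[Fp L] L) : L →+* L) ((gramR L e dV hdV dW hdW).map (algebraMap (Fp L) L))) (h : HA L e dV hdV dW hdW) (s : ℂ), (S : Matrix (Fin n) (Fin n) L).det ≠ 0 →
        A S s h = ∑ j, Finf j S s h * ∏ v ∈ kindWFinset L e dV hdV dW hdW T₀ (S : Matrix (Fin n) (Fin n) L) h, Ffin j S h v s) := by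
  classical
  refine ⟨fun S s h => if (S : Matrix (Fin n) (Fin n) L).det = 0 then 0 else ∑ j, Finf j S s h * ∏ v ∈ kindWFinset L e dV hdV dW hdW T₀ (S : Matrix (Fin n) (Fin n) L) h, Ffin j S h v s,
    ?_, ?_, ?_, ?_⟩
  · -- (i) the Euler identity on `{n∕2 < re s}`: ★ (x-a) §3 with `hG`, `hJ`, then `hPart`
    intro S hdet s h hs
    have hs0 : 0 < s.re := lt_of_le_of_lt (by positivity) hs
    have hW := whittakerDelta_eq_kindWPart_mul L e dV hdV dW hdW T₀ νN νv hνK νinf hσ hmap hχ hfac (S : Matrix (Fin n) (Fin n) L) hs0 h (hG S s h hs hdet) (hJ S h s hs hdet)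
    rw [hW, hPart S h s hs hdet]
    simp only [if_neg hdet]
  · -- (ii) holomorphy on `{0 < re s}`
    intro S h
    by_cases hdet : (S : Matrix (Fin n) (Fin n) L).det = 0
    · simp only [if_pos hdet]
      exact differentiableOn_const 0
    · simp only [if_neg hdet]
      exact DifferentiableOn.fun_sum fun j _ => (hFinf j S h).mul (DifferentiableOn.fun_finsetProd fun v _ => hFfin j S h v)
  · -- (iii) `A := 0` at singular indices
    intro S s h hdet
    simp only [if_pos hdet]
  · -- (iv) the Σ∏ presentation
    intro S h s hdet
    simp only [if_neg hdet]

end Summit.HodgeConjecture.HodgeConjecture.Cruxes.HLiu418.K2LiuSiegelEisensteinKindWEulerLetters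

end
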